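import Mathlib.RingTheory.Polynomial.GaussLemma
import Mathlib.FieldTheory.Minpoly.Field
import Mathlib.RingTheory.Algebraic.Basic
import Mathlib.Analysis.SpecialFunctions.Log.Basic
import Mathlib.Analysis.Complex.ExponentialBounds
import Literature.Computability.AlgebraicComplexity.BurgisserBooleanPartsA3Steps
import HarnessLib

/-!
# Bürgisser's reduction modulo primes (TCS 2000, Thm. 4.1) from its two ingredients

Trunk T-CPLX-ALG. Bürgisser, *Cook's versus Valiant's hypothesis*, TCS 235 (2000) 71–88, §4,
proves Theorem 4.1 — under GRH an integer polynomial system of degree `≤ d`, weight `≤ w`,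
`n < d` unknowns, solvable over `ℂ`, is solvable modulo at least
`π(x)/d^{O(n)} - O(x^{1/2} log(wx))` primes `p ≤ x` — "by combining Theorem 4.5, Remark 4.6, and
Corollary 4.8" (p. 84). Theorem 4.1 is the named fact `Literature.Computability.AlgebraicComplexity.reduction_mod_primes_of_GRH` of
`BurgisserBooleanParts.lean`, the only unproved ingredient left in the tree's proof of
Bürgisser's `VP = VNP ⟹ P/poly = NP/poly` (GRH, char. 0; `ValiantBooleanBridge.lean`,
`BurgisserBooleanPartsA3Assembly.lean`). This file performs the printed combination: it vendors
the two deep ingredients as named facts and proves everything else.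

* `algebraicSolution_height_bound` — **Theorem 4.5** (p. 82; after Krick–Pardo's arithmetic
  geometric resolution [18, Prop. 27], Bézout's inequality and Mignotte's bound, Lemmas 4.2–4.4):
  a solvable system has a solution `x_i = λ⁻¹ v_i(y)`, `y` algebraic with primitive minimal
  polynomial `g`, with `deg g, deg v_i ≤ d^{O(n)}` and `log λ, log wt(g), log wt(v_i) ≤ d^{O(n)} log w`.
  Named fact (its proof is a theory of its own: equidimensional decomposition, Bézout, heights).
* `rootModPrimeCount_lower_bound_of_GRH` — **Corollary 4.8** (p. 84; Weinberger [28, 29],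
  Lagarias–Odlyzko [19]: the effective prime ideal theorem under GRH, eq. (3) p. 83, and
  Thm. 4.7): for irreducible `g ∈ ℤ[Y]` of degree `d` and weight `≤ w`,
  `π_g(x) ≥ π(x)/d - O(x^{1/2} log(dwx) + d log(dw))` under GRH. Named fact (needs the analytic
  continuation of Dedekind zeta functions and the explicit formula; Mathlib has neither).
* **Remark 4.6**, proved: `numeratorPoly`, `aeval_numeratorPoly` (the division-free numerator
  `h = λ^D f(λ⁻¹ v(Y))`), `dvd_of_aeval_eq_zero` (a primitive irreducible `g` with `g(y) = 0`
  divides every integer polynomial vanishing at `y`: minimal polynomial over `ℚ` + Gauss's lemma),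
  `exists_solution_mod_of_root_mod` (a root of `g` modulo `p ∤ λ` gives a solution modulo `p`).
* The counting step `rootModPrimeCount_le` (`π_g(x) ≤ π_S(x) + ω(λ)`) and
  `card_primeFactors_mul_log_two_le` (`ω(λ) log 2 ≤ log λ`), proved.
* **The combination** `reduction_mod_primes_of_GRH_of_facts : Thm 4.5 → Cor 4.8 → Thm 4.1`,
  proved, with the real bookkeeping isolated in `thm41_junk` and `thm41_absorb`: for `x ≥ 2`,
  `π_S(x) ≥ π(x)/A - (7K + 2) A² √x log(wx)` with `A = a d^{an}`, and either the right-hand side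
  of Thm. 4.1 (with `c = 4a`, `C = 2(7K+2)a² + 1`) is `≤ 0 ≤ π_S(x)`, or `√x log(wx)` is so
  small that the junk is `≤ π(x)/(2 d^{2an})` and `1/D⁴ + 1/(2D²) ≤ 1/(aD)` (`D = d^{an} ≥ 2a`)
  concludes. (The printed statement leaves this bookkeeping to the reader.)

Consequently the target fact `PPoly_eq_polyAdvice_NP_of_VP_eq_VNP k` depends on exactly the two
external theorems Thm. 4.5 (Krick–Pardo heights) and Cor. 4.8 (effective Chebotarev under GRH).

## References
* [Burgisser2000TCS] P. Bürgisser, Cook's versus Valiant's hypothesis, Theoret. Comput. Sci.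
  235 (2000) 71–88, §4 (Thm. 4.1 p. 79, Lemmas 4.2–4.4 pp. 80–81, Thm. 4.5 p. 82, Rem. 4.6
  p. 83, eq. (3) and Thm. 4.7 p. 83, Cor. 4.8 p. 84).
* T. Krick, L. M. Pardo, A computational method for Diophantine approximation, Progr. Math. 143
  (1996) 193–253 (Bürgisser's [18], Prop. 27).
* J. C. Lagarias, A. M. Odlyzko, Effective versions of the Chebotarev density theorem (1977)
  (Bürgisser's [19]); P. J. Weinberger, Finding the number of factors of a polynomial,
  J. Algorithms 5 (1984) 180–186 (Bürgisser's [29]).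
-/

noncomputable section

open scoped Classical
open MvPolynomial Literature.Computability.Complexity Literature.Computability.AlgebraicComplexity

namespace Literature.Computability.AlgebraicComplexity

/-! ### Weights of univariate integer polynomials and the prime counts `π_g` -/

/-- The weight of a univariate integer polynomial: the sum of the absolute values of its
coefficients (Bürgisser 2000 TCS, p. 76, univariate case; Cor. 4.8 "of degree `d` and weight
`w`"). [cite: Burgisser2000TCS, p. 76] -/
def polyWeight (g : Polynomial ℤ) : ℕ :=
  g.support.sum fun i => (g.coeff i).natAbs

/-- `π_g(x)`: the number of primes `p ≤ x` such that `g` has a root modulo `p`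
(Bürgisser 2000 TCS, p. 84). [cite: Burgisser2000TCS, §4.2 p. 84] -/
def rootModPrimeCount (g : Polynomial ℤ) (x : ℕ) : ℕ :=
  ((Finset.range (x + 1)).filter fun p =>
    p.Prime ∧ ∃ y : ZMod p, Polynomial.aeval y g = 0).card

/-! ### The two named facts: Theorem 4.5 and Corollary 4.8 -/

/-- **Algebraic solutions of small height** (Bürgisser 2000 TCS, Thm. 4.5, p. 82, after
Krick–Pardo): "The system (S) has a solution `x = (x_i)` of the form `x_i = λ⁻¹ v_i(y)`. Here
`λ` is a positive integer, `v_i ∈ ℤ[Y]` is an integer polynomial, and `y` is an algebraic number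
with primitive integer minimal polynomial `g ∈ ℤ[Y]` such that
`max{deg g, deg v_i} = d^{O(n)}`, `max{log λ, log wt(g), log wt(v_i)} = d^{O(n)} log w`." Here (S)
is a system `f_1 = … = f_s = 0`, `f_i ∈ ℤ[X_1, …, X_n]` of degree and weight bounded by `d` and
`w`, `n < d` (the side condition of §4, see `reduction_mod_primes_of_GRH`), solvable over `ℂ`.
The `O`-constants are rendered by one existential natural `a`, every bound reading
`≤ a · d^{a n}` (resp. `≤ a · d^{a n} · log w`), which is implied by the printed `d^{O(n)}`;
"minimal polynomial" is rendered as "irreducible primitive `g ∈ ℤ[Y]` with `g(y) = 0`". Proof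
printed on pp. 80–83 (Lemmas 4.2–4.4: Bézout; Krick–Pardo [18, Prop. 27]; Mignotte's bound). [cite: Burgisser2000TCS, Thm. 4.5 p. 82] -/
def algebraicSolution_height_bound : Prop :=
  ∃ a : ℕ, ∀ (n s d w : ℕ) (S : Fin s → MvPolynomial (Fin n) ℤ),
    n < d → (∀ i, (S i).totalDegree ≤ d) → (∀ i, weight (S i) ≤ w) →
    (∃ z : Fin n → ℂ, ∀ i, aeval z (S i) = 0) →
    ∃ (lam : ℕ) (v : Fin n → Polynomial ℤ) (g : Polynomial ℤ) (y : ℂ),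
      0 < lam ∧ Irreducible g ∧ g.IsPrimitive ∧ 0 < g.natDegree ∧ Polynomial.aeval y g = 0 ∧
      (∀ i, aeval (fun j => (lam : ℂ)⁻¹ * Polynomial.aeval y (v j)) (S i) = 0) ∧
      (g.natDegree : ℝ) ≤ a * (d : ℝ) ^ (a * n) ∧
      (∀ j, ((v j).natDegree : ℝ) ≤ a * (d : ℝ) ^ (a * n)) ∧
      Real.log lam ≤ a * (d : ℝ) ^ (a * n) * Real.log w ∧
      Real.log (polyWeight g) ≤ a * (d : ℝ) ^ (a * n) * Real.log w ∧
      ∀ j, Real.log (polyWeight (v j)) ≤ a * (d : ℝ) ^ (a * n) * Real.log w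

/-- **Primes with a root modulo `p`, under GRH** (Bürgisser 2000 TCS, Cor. 4.8, p. 84, after
Weinberger and Lagarias–Odlyzko): "For all irreducible univariate polynomials `g ∈ ℤ[Y]` of
degree `d` and weight `w` we have `π_g(x) ≥ π(x)/d - O(x^{1/2} log(dwx) + d log(dw))`, provided
(GRH) is true", where `π_g(x)` counts the primes `p ≤ x` such that `g` has a root modulo `p`
and (GRH) is the Riemann hypothesis for the Dedekind zeta functions of number fields (p. 83),
i.e. `Literature.NumberTheory.LFunctions.ExtendedRiemannHypothesis`. The `O`-constant is an existential `K ≥ 0`, uniform in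
`g` ("The constant implicit in the O-term does not depend on `g`", p. 83); `w` is any bound for
the weight (the error term is monotone in `w`). Source chain: the effective prime ideal theorem
under GRH, eq. (3) p. 83 (Weinberger [28]; Lagarias–Odlyzko [19]) and Thm. 4.7 (Weinberger [29]). [cite: Burgisser2000TCS, Cor. 4.8 p. 84] -/
def rootModPrimeCount_lower_bound_of_GRH : Prop :=
  Literature.NumberTheory.LFunctions.ExtendedRiemannHypothesis →
    ∃ K : ℝ, 0 ≤ K ∧ ∀ (g : Polynomial ℤ) (w : ℕ), Irreducible g → 0 < g.natDegree →
      polyWeight g ≤ w → ∀ x : ℕ,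
        (Nat.primeCounting x : ℝ) / g.natDegree -
            K * (Real.sqrt x * Real.log (g.natDegree * w * x) +
              g.natDegree * Real.log (g.natDegree * w)) ≤
          (rootModPrimeCount g x : ℝ)

/-! ### Remark 4.6: roots of `g` modulo `p` give solutions modulo `p` -/

section Remark46

variable {n : ℕ}

/-- The numerator polynomial `h(Y) = λ^D f(λ⁻¹ v_1(Y), …, λ⁻¹ v_n(Y)) ∈ ℤ[Y]` of Remark 4.6,
written without division: `∑_α c_α λ^{D - |α|} ∏_j v_j^{α_j}` over the monomials `c_α X^α` of
`f` (Bürgisser 2000 TCS, Rem. 4.6, p. 83: "`h_i(Y) := λ^d f_i(λ⁻¹ v_1(Y), …, λ⁻¹ v_n(Y))`"). [cite: Burgisser2000TCS, Rem. 4.6 p. 83] -/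
def numeratorPoly (f : MvPolynomial (Fin n) ℤ) (D : ℕ) (lam : ℤ) (v : Fin n → Polynomial ℤ) :
    Polynomial ℤ :=
  ∑ α ∈ f.support, Polynomial.C (f.coeff α * lam ^ (D - α.sum fun _ e => e)) * ∏ j, v j ^ α j

/-- The evaluation identity `h(t) = λ^D · f(λ⁻¹ v_1(t), …, λ⁻¹ v_n(t))` in any commutative ring
in which `λ` is invertible (Bürgisser 2000 TCS, Rem. 4.6). [cite: Burgisser2000TCS, Rem. 4.6 p. 83] -/
theorem aeval_numeratorPoly {R : Type*} [CommRing R] (f : MvPolynomial (Fin n) ℤ) {D : ℕ}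
    (hD : f.totalDegree ≤ D) {lam : ℤ} (u : Rˣ) (hu : (u : R) = lam) (v : Fin n → Polynomial ℤ)
    (t : R) :
    Polynomial.aeval t (numeratorPoly f D lam v) =
      (lam : R) ^ D * aeval (fun j => (↑u⁻¹ : R) * Polynomial.aeval t (v j)) f := by
  rw [MvPolynomial.aeval_def, MvPolynomial.eval₂_eq', Finset.mul_sum, numeratorPoly, map_sum]
  refine Finset.sum_congr rfl fun α hα => ?_
  have hdeg : (α.sum fun _ e => e) ≤ D := (le_totalDegree hα).trans hD
  simp only [map_mul, map_prod, map_pow, algebraMap_int_eq, eq_intCast, map_intCast,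
    mul_pow, Finset.prod_mul_distrib, Finset.prod_pow_eq_pow_sum]
  -- `λ^D (u⁻¹)^{|α|} = λ^{D-|α|}`
  have hsum : (∑ j, α j) = α.sum fun _ e => e := by
    rw [Finsupp.sum_fintype]; intro; rfl
  rw [hsum]
  set m := α.sum fun _ e => e with hm
  have hlam : (lam : R) ^ D = (lam : R) ^ (D - m) * (u : R) ^ m := by
    rw [hu, ← pow_add, Nat.sub_add_cancel hdeg]
  rw [hlam]
  have hu' : (u : R) ^ m * (↑u⁻¹ : R) ^ m = 1 := by
    rw [← mul_pow, Units.mul_inv, one_pow]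
  -- rearrange
  calc (((f.coeff α : ℤ) : R) * (lam : R) ^ (D - m)) * ∏ j, (Polynomial.aeval t) (v j) ^ α j
      = (((f.coeff α : ℤ) : R) * (lam : R) ^ (D - m)) * ((u : R) ^ m * (↑u⁻¹ : R) ^ m) *
          ∏ j, (Polynomial.aeval t) (v j) ^ α j := by rw [hu', mul_one]
    _ = (lam : R) ^ (D - m) * (u : R) ^ m *
          (((f.coeff α : ℤ) : R) * ((↑u⁻¹ : R) ^ m * ∏ j, (Polynomial.aeval t) (v j) ^ α j)) := by
        ring

/-- `h(y) = 0` for the algebraic solution `x_j = λ⁻¹ v_j(y)` (Bürgisser 2000 TCS, Rem. 4.6: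
"As `(λ⁻¹ v_i(y))_i` is a solution of (S), we have `h_i(y) = 0`"). [cite: Burgisser2000TCS, Rem. 4.6 p. 83] -/
theorem aeval_numeratorPoly_eq_zero (f : MvPolynomial (Fin n) ℤ) {D : ℕ} (hD : f.totalDegree ≤ D)
    {lam : ℕ} (hlam : 0 < lam) (v : Fin n → Polynomial ℤ) {y : ℂ}
    (hsol : aeval (fun j => (lam : ℂ)⁻¹ * Polynomial.aeval y (v j)) f = 0) :
    Polynomial.aeval y (numeratorPoly f D lam v) = 0 := by
  have hne : (lam : ℂ) ≠ 0 := by exact_mod_cast hlam.ne'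
  rw [aeval_numeratorPoly f hD (Units.mk0 (lam : ℂ) hne) (by simp) v y]
  simp only [Units.val_inv_eq_inv_val, Units.val_mk0]
  rw [hsol, mul_zero]

/-- A primitive irreducible integer polynomial with a complex root `y` divides, in `ℤ[Y]`, every
integer polynomial vanishing at `y` (minimal polynomial property + Gauss's lemma; Bürgisser 2000
TCS, Rem. 4.6: "the minimal polynomial `g` is a factor of `h_i` in `ℚ[Y]`. Since we assume `g`
to be primitive, it is even a factor of `h_i` in `ℤ[Y]`"). [cite: Burgisser2000TCS, Rem. 4.6 p. 83] -/
theorem dvd_of_aeval_eq_zero {g h : Polynomial ℤ} (hirr : Irreducible g) (hprim : g.IsPrimitive)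
    {y : ℂ} (hgy : Polynomial.aeval y g = 0) (hhy : Polynomial.aeval y h = 0) : g ∣ h := by
  rw [Polynomial.IsPrimitive.Int.dvd_iff_map_cast_dvd_map_cast g h hprim]
  have hirrQ : Irreducible (g.map (Int.castRingHom ℚ)) :=
    (Polynomial.IsPrimitive.Int.irreducible_iff_irreducible_map_cast hprim).1 hirr
  have hgyQ : Polynomial.aeval y (g.map (Int.castRingHom ℚ)) = 0 := by
    rwa [show Int.castRingHom ℚ = algebraMap ℤ ℚ from rfl, Polynomial.aeval_map_algebraMap]
  have hhyQ : Polynomial.aeval y (h.map (Int.castRingHom ℚ)) = 0 := by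
    rwa [show Int.castRingHom ℚ = algebraMap ℤ ℚ from rfl, Polynomial.aeval_map_algebraMap]
  have hint : IsIntegral ℚ y :=
    (isAlgebraic_iff_isIntegral.1 ⟨_, hirrQ.ne_zero, hgyQ⟩)
  have h1 : minpoly ℚ y ∣ g.map (Int.castRingHom ℚ) := minpoly.dvd ℚ y hgyQ
  have h2 : g.map (Int.castRingHom ℚ) ∣ minpoly ℚ y :=
    (minpoly.irreducible hint).dvd_symm hirrQ h1
  exact h2.trans (minpoly.dvd ℚ y hhyQ)

/-- **Remark 4.6** (Bürgisser 2000 TCS, p. 83): if `x_j = λ⁻¹ v_j(y)` solves (S) with `y` a root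
of the primitive irreducible `g ∈ ℤ[Y]`, then for every prime `p ∤ λ` and every root `ȳ` of `g`
modulo `p`, the point `(λ⁻¹ v_j(ȳ))_j` solves (S) over `𝔽_p`. [cite: Burgisser2000TCS, Rem. 4.6 p. 83] -/
theorem exists_solution_mod_of_root_mod {s : ℕ} (S : Fin s → MvPolynomial (Fin n) ℤ)
    {lam : ℕ} (hlam : 0 < lam) (v : Fin n → Polynomial ℤ) {g : Polynomial ℤ}
    (hirr : Irreducible g) (hprim : g.IsPrimitive) {y : ℂ} (hgy : Polynomial.aeval y g = 0)
    (hsol : ∀ i, aeval (fun j => (lam : ℂ)⁻¹ * Polynomial.aeval y (v j)) (S i) = 0)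
    {p : ℕ} [Fact p.Prime] (hp : ¬ p ∣ lam) {yb : ZMod p} (hyb : Polynomial.aeval yb g = 0) :
    ∃ z : Fin n → ZMod p, ∀ i, aeval z (S i) = 0 := by
  have hne : (lam : ZMod p) ≠ 0 := by
    rwa [Ne, ZMod.natCast_eq_zero_iff]
  refine ⟨fun j => (lam : ZMod p)⁻¹ * Polynomial.aeval yb (v j), fun i => ?_⟩
  have hdvd : g ∣ numeratorPoly (S i) (S i).totalDegree lam v :=
    dvd_of_aeval_eq_zero hirr hprim hgy (aeval_numeratorPoly_eq_zero (S i) le_rfl hlam v (hsol i))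
  obtain ⟨r, hr⟩ := hdvd
  have hzero : Polynomial.aeval yb (numeratorPoly (S i) (S i).totalDegree lam v) = 0 := by
    rw [hr, map_mul, hyb, zero_mul]
  rw [aeval_numeratorPoly (S i) le_rfl (Units.mk0 (lam : ZMod p) hne) (by simp) v yb] at hzero
  simp only [Units.val_inv_eq_inv_val, Units.val_mk0, Int.cast_natCast] at hzero
  exact (mul_eq_zero.1 hzero).resolve_left (pow_ne_zero _ hne)

end Remark46

/-! ### Counting: `π_g(x) ≤ π_S(x) + ω(λ)` -/

section Counting

variable {n s : ℕ}

/-- The number of distinct prime factors of `m ≥ 1` is at most `log₂ m`. [folklore] -/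
theorem card_primeFactors_mul_log_two_le {m : ℕ} (hm : 0 < m) :
    (m.primeFactors.card : ℝ) * Real.log 2 ≤ Real.log m := by
  have h1 : 2 ^ m.primeFactors.card ≤ m := by
    calc 2 ^ m.primeFactors.card = ∏ _p ∈ m.primeFactors, 2 := by simp
      _ ≤ ∏ p ∈ m.primeFactors, p :=
          Finset.prod_le_prod' fun p hp => (Nat.prime_of_mem_primeFactors hp).two_le
      _ ≤ m := Nat.le_of_dvd hm (Nat.prod_primeFactors_dvd m)
  have h2 : ((2 : ℕ) ^ m.primeFactors.card : ℝ) ≤ (m : ℝ) := by exact_mod_cast h1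
  rw [← Real.log_pow]
  exact Real.log_le_log (by positivity) (by exact_mod_cast h2)

/-- `π_g(x) ≤ π_S(x) + ω(λ)`: a prime `p ≤ x` with a root of `g` modulo `p` either divides `λ` or
admits a solution of (S) modulo `p` (Bürgisser 2000 TCS, p. 84: "The proof of Theorem 4.1
follows now easily by combining Theorem 4.5, Remark 4.6, and Corollary 4.8"). [cite: Burgisser2000TCS, §4 p. 84] -/
theorem rootModPrimeCount_le (S : Fin s → MvPolynomial (Fin n) ℤ) {lam : ℕ} (hlam : 0 < lam)
    (v : Fin n → Polynomial ℤ) {g : Polynomial ℤ} (hirr : Irreducible g) (hprim : g.IsPrimitive)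
    {y : ℂ} (hgy : Polynomial.aeval y g = 0)
    (hsol : ∀ i, aeval (fun j => (lam : ℂ)⁻¹ * Polynomial.aeval y (v j)) (S i) = 0) (x : ℕ) :
    rootModPrimeCount g x ≤ solvableModPrimeCount S x + lam.primeFactors.card := by
  unfold rootModPrimeCount solvableModPrimeCount
  refine le_trans (Finset.card_le_card ?_) (Finset.card_union_le _ _)
  intro p hp
  simp only [Finset.mem_filter, Finset.mem_range] at hp
  obtain ⟨hpx, hprime, yb, hyb⟩ := hp
  rw [Finset.mem_union]
  by_cases hdiv : p ∣ lam
  · exact Or.inr (Nat.mem_primeFactors.2 ⟨hprime, hdiv, hlam.ne'⟩)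
  · left
    haveI : Fact p.Prime := ⟨hprime⟩
    simp only [Finset.mem_filter, Finset.mem_range]
    exact ⟨hpx, hprime, exists_solution_mod_of_root_mod S hlam v hirr hprim hgy hsol hdiv hyb⟩

/-- The zero system is solvable modulo every prime: `π_0(x) = π(x)`. [folklore] -/
theorem solvableModPrimeCount_of_forall_eq_zero (S : Fin s → MvPolynomial (Fin n) ℤ)
    (h0 : ∀ i, S i = 0) (x : ℕ) : solvableModPrimeCount S x = Nat.primeCounting x := by
  unfold solvableModPrimeCount
  rw [Nat.primeCounting, Nat.primeCounting', Nat.count_eq_card_filter_range]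
  congr 1
  refine Finset.filter_congr fun p _ => ?_
  simp only [and_iff_left_iff_imp]
  intro _
  exact ⟨fun _ => 0, fun i => by rw [h0 i, map_zero]⟩

/-- A polynomial of weight `0` is `0`. [folklore] -/
theorem eq_zero_of_weight_eq_zero {σ : Type*} {f : MvPolynomial σ ℤ} (h : weight f = 0) : f = 0 := by
  rw [weight, Finset.sum_eq_zero_iff] at h
  ext m
  by_cases hm : m ∈ f.support
  · simpa using h m hm
  · simpa [MvPolynomial.mem_support_iff] using hm

/-- A system in no unknowns that is solvable over `ℂ` is the zero system. [folklore] -/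
theorem eq_zero_of_solvable_of_isEmpty {σ : Type*} [IsEmpty σ] {f : MvPolynomial σ ℤ} {z : σ → ℂ}
    (h : aeval z f = 0) : f = 0 := by
  obtain ⟨c, rfl⟩ : ∃ c : ℤ, f = C c := ⟨_, MvPolynomial.eq_C_of_isEmpty f⟩
  rw [MvPolynomial.aeval_C, algebraMap_int_eq, eq_intCast, Int.cast_eq_zero] at h
  rw [h, C_0]

/-- `polyWeight g = 0 ↔ g = 0`; in particular a nonzero polynomial has weight `≥ 1`. [folklore] -/
theorem one_le_polyWeight {g : Polynomial ℤ} (hg : g ≠ 0) : 1 ≤ polyWeight g := by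
  rw [Nat.one_le_iff_ne_zero]
  intro h
  apply hg
  rw [polyWeight, Finset.sum_eq_zero_iff] at h
  ext i
  by_cases hi : i ∈ g.support
  · simpa using h i hi
  · simpa [Polynomial.mem_support_iff] using hi

end Counting

/-! ### The combination: Theorem 4.1 from Theorem 4.5 and Corollary 4.8 -/

section Combination

/-- `2 a ≤ 2 ^ a` for `a ≥ 1`. [folklore] -/
theorem two_mul_le_two_pow {a : ℕ} (ha : 1 ≤ a) : 2 * a ≤ 2 ^ a := by
  induction a, ha using Nat.le_induction with
  | base => norm_num
  | succ a ha ih => rw [pow_succ]; omega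

/-- The elementary inequality behind the choice `c = 4a`: `1/D⁴ + 1/(2D²) ≤ 1/(aD)` once
`D ≥ 2a`, `a ≥ 1`. [folklore] -/
theorem thm41_key {a D : ℝ} (ha : 1 ≤ a) (hD : 2 * a ≤ D) :
    1 / D ^ 4 + 1 / (2 * D ^ 2) ≤ 1 / (a * D) := by
  have hD2 : 2 ≤ D := by linarith
  have hDpos : 0 < D := by linarith
  rw [div_add_div _ _ (by positivity) (by positivity),
    div_le_div_iff₀ (by positivity) (by positivity)]
  have h1 : a * (2 + D ^ 2) ≤ D / 2 * (2 + D ^ 2) :=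
    mul_le_mul_of_nonneg_right (by linarith) (by positivity)
  have h4 : D ≤ D ^ 3 := by
    calc D = D * 1 * 1 := by ring
      _ ≤ D * D * D := by gcongr <;> linarith
      _ = D ^ 3 := by ring
  have h2 : D / 2 * (2 + D ^ 2) ≤ 2 * D ^ 3 := by
    have : D / 2 * (2 + D ^ 2) = D + D ^ 3 / 2 := by ring
    rw [this]; linarith
  have h3 : (0 : ℝ) ≤ D ^ 3 := by positivity
  calc (1 * (2 * D ^ 2) + D ^ 4 * 1) * (a * D) = D ^ 3 * (a * (2 + D ^ 2)) := by ring
    _ ≤ D ^ 3 * (2 * D ^ 3) := mul_le_mul_of_nonneg_left (h1.trans h2) h3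
    _ = 1 * (D ^ 4 * (2 * D ^ 2)) := by ring

/-- The absorption step of the combination (real bookkeeping): if
`π_S ≥ P/(aD) - J` with junk `J ≤ K₁ (aD)² · (√x L)`, then
`π_S ≥ P/D⁴ - (2 K₁ a² + 1) √x L`; either the right-hand side is `≤ 0`, or `√x L` is so small
that the junk is at most `P/(2D²)` and `thm41_key` applies. [folklore] -/
theorem thm41_absorb {P D a K₁ J sx L πS : ℝ} (hP : 0 ≤ P) (ha : 1 ≤ a) (hD : 2 * a ≤ D)
    (hK₁ : 0 ≤ K₁) (hsx : 0 ≤ sx) (hL : 0 ≤ L) (hπS0 : 0 ≤ πS)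
    (hJ : J ≤ K₁ * (a * D) ^ 2 * (sx * L)) (hπS : P / (a * D) - J ≤ πS) :
    P / D ^ 4 - (2 * K₁ * a ^ 2 + 1) * sx * L ≤ πS := by
  have hDpos : 0 < D := by linarith
  have hC : 0 < 2 * K₁ * a ^ 2 + 1 := by positivity
  have hT : 0 ≤ sx * L := mul_nonneg hsx hL
  have hCT : 0 ≤ (2 * K₁ * a ^ 2 + 1) * (sx * L) := mul_nonneg hC.le hT
  by_cases hcase : P / D ^ 4 ≤ (2 * K₁ * a ^ 2 + 1) * (sx * L)
  · linarith
  · push Not at hcase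
    have h1 : (2 * K₁ * a ^ 2 + 1) * (sx * L) * D ^ 4 ≤ P :=
      (le_div_iff₀ (by positivity)).1 hcase.le
    have h2 : 2 * D ^ 2 * (K₁ * (a * D) ^ 2 * (sx * L)) ≤ P := by
      calc 2 * D ^ 2 * (K₁ * (a * D) ^ 2 * (sx * L))
          = (2 * K₁ * a ^ 2) * (sx * L) * D ^ 4 := by ring
        _ ≤ (2 * K₁ * a ^ 2 + 1) * (sx * L) * D ^ 4 := by gcongr; linarith
        _ ≤ P := h1
    have hJ' : J ≤ P / (2 * D ^ 2) := hJ.trans ((le_div_iff₀' (by positivity)).2 h2)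
    have h3 : P / D ^ 4 + P / (2 * D ^ 2) ≤ P / (a * D) := by
      have := mul_le_mul_of_nonneg_left (thm41_key ha hD) hP
      simpa only [mul_add, mul_one_div] using this
    linarith

/-- The junk terms of the combination (real bookkeeping): with `A` a common bound for `deg g`,
`log deg g`, and (after multiplication by `log w ≤ L`) for `log wt(g)` and `log λ`, and with
`L ≥ 1/2`, `√x ≥ 1`, the error terms of Cor. 4.8 plus the number `ω ≤ log λ / log 2` of primes
dividing `λ` are at most `(7K + 2) A² √x L`. [folklore] -/
theorem thm41_junk {K A L sx δ lδ lwg lx llam ω : ℝ} (hK : 0 ≤ K) (hA : 1 ≤ A)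
    (hL : 1 / 2 ≤ L) (hsx : 1 ≤ sx) (hδA : δ ≤ A) (hlδ0 : 0 ≤ lδ) (hlδ : lδ ≤ A)
    (hlwg0 : 0 ≤ lwg) (hlwg : lwg ≤ A * L) (hlx : lx ≤ L)
    (hllam : llam ≤ A * L) (hω : ω * (1 / 2) ≤ llam) :
    K * (sx * (lδ + lwg + lx) + δ * (lδ + lwg)) + ω ≤ (7 * K + 2) * A ^ 2 * (sx * L) := by
  have hL0 : 0 ≤ L := by linarith
  have hA0 : 0 ≤ A := by linarith
  have hAL0 : 0 ≤ A * L := mul_nonneg hA0 hL0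
  have hAL : A ≤ 2 * (A * L) := by
    calc A = A * 1 := (mul_one A).symm
      _ ≤ A * (2 * L) := mul_le_mul_of_nonneg_left (by linarith) hA0
      _ = 2 * (A * L) := by ring
  have hLAL : L ≤ A * L := le_mul_of_one_le_left hL0 hA
  have s1 : lδ + lwg + lx ≤ 4 * (A * L) := by linarith
  have s3 : lδ + lwg ≤ 3 * (A * L) := by linarith
  have s2 : sx * (lδ + lwg + lx) ≤ sx * (4 * (A * L)) :=
    mul_le_mul_of_nonneg_left s1 (by linarith)
  have s4 : δ * (lδ + lwg) ≤ A * (3 * (A * L)) := mul_le_mul hδA s3 (by linarith) hA0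
  have s5 : ω ≤ 2 * (A * L) := by linarith
  have hAA : A ≤ A ^ 2 := by nlinarith
  have e1 : A * L ≤ A ^ 2 * L := mul_le_mul_of_nonneg_right hAA hL0
  have e2 : A ^ 2 * L ≤ A ^ 2 * L * sx := le_mul_of_one_le_right (by positivity) hsx
  have t3 : A * L ≤ A ^ 2 * L * sx := e1.trans e2
  have t1 : A * L * sx ≤ A ^ 2 * L * sx := mul_le_mul_of_nonneg_right e1 (by linarith)
  have u : K * (sx * (lδ + lwg + lx) + δ * (lδ + lwg)) ≤ K * (7 * (A ^ 2 * L * sx)) := by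
    refine mul_le_mul_of_nonneg_left ?_ hK
    linarith
  linarith

/-- **Theorem 4.1 from Theorem 4.5 and Corollary 4.8** (Bürgisser 2000 TCS, p. 84: "The proof
of Theorem 4.1 follows now easily by combining Theorem 4.5, Remark 4.6, and Corollary 4.8"):
the named fact `reduction_mod_primes_of_GRH` (TCS Thm. 4.1: under GRH,
`π_S(x) ≥ π(x)/d^{O(n)} - O(x^{1/2} log(wx))` for integer systems of degree `≤ d`, `n < d`, weight
`≤ w`, solvable over `ℂ`) follows from the height bound for an algebraic solution (Thm. 4.5,
`algebraicSolution_height_bound`) and the GRH-conditional count of primes modulo which the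
minimal polynomial has a root (Cor. 4.8, `rootModPrimeCount_lower_bound_of_GRH`); Remark 4.6
(`exists_solution_mod_of_root_mod`, `rootModPrimeCount_le`) and the bookkeeping are proved here.
Bookkeeping: with `A = a d^{an}` (`a` the constant of Thm. 4.5, enlarged to be `≥ 1`) one has
`π_S ≥ π_g - ω(λ) ≥ π(x)/A - (7K + 2) A² √x log(wx)` for `x ≥ 2`, and `thm41_absorb` yields the
printed shape with `c = 4a`, `C = 2 (7K + 2) a² + 1`; the zero system, `x ≤ 1`, and the
resulting `n ≥ 1`, `w ≥ 1`, `d ≥ 2` are handled separately. [cite: Burgisser2000TCS, Thm. 4.1 p. 79 and §4 p. 84] -/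
theorem reduction_mod_primes_of_GRH_of_facts (h45 : algebraicSolution_height_bound)
    (h48 : rootModPrimeCount_lower_bound_of_GRH) : reduction_mod_primes_of_GRH := by
  intro hERH
  obtain ⟨a₀, h45⟩ := h45
  obtain ⟨K, hK0, h48⟩ := h48 hERH
  obtain ⟨a, ha1, ha0⟩ : ∃ a : ℕ, 1 ≤ a ∧ a₀ ≤ a := ⟨max a₀ 1, le_max_right _ _, le_max_left _ _⟩
  have hC0 : (0 : ℝ) ≤ 2 * (7 * K + 2) * (a : ℝ) ^ 2 + 1 := by positivity
  refine ⟨((4 * a : ℕ) : ℝ), 2 * (7 * K + 2) * (a : ℝ) ^ 2 + 1, by positivity, hC0, ?_⟩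
  intro n s d w S hnd hdeg hwt hsol x
  rw [show ((4 * a : ℕ) : ℝ) * (n : ℝ) = ((4 * a * n : ℕ) : ℝ) by push_cast; ring,
    Real.rpow_natCast]
  have hL0 : 0 ≤ Real.log ((w : ℝ) * x) := by
    rw [← Nat.cast_mul]; exact Real.log_natCast_nonneg _
  have hsx0 : 0 ≤ Real.sqrt (x : ℝ) := Real.sqrt_nonneg _
  have hCT : 0 ≤ (2 * (7 * K + 2) * (a : ℝ) ^ 2 + 1) * Real.sqrt x * Real.log ((w : ℝ) * x) :=
    mul_nonneg (mul_nonneg hC0 hsx0) hL0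
  have hπS0 : (0 : ℝ) ≤ solvableModPrimeCount S x := Nat.cast_nonneg _
  have hπ0 : (0 : ℝ) ≤ Nat.primeCounting x := Nat.cast_nonneg _
  have hd1 : 1 ≤ d := by omega
  -- degenerate case: the zero system (`π_S = π`)
  by_cases hzero : ∀ i, S i = 0
  · rw [solvableModPrimeCount_of_forall_eq_zero S hzero]
    have h1 : (Nat.primeCounting x : ℝ) / (d : ℝ) ^ (4 * a * n) ≤ Nat.primeCounting x :=
      div_le_self hπ0 (one_le_pow₀ (by exact_mod_cast hd1))
    linarith
  push Not at hzero
  obtain ⟨i₀, hi₀⟩ := hzero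
  -- hence `n ≥ 1`, `w ≥ 1`, `d ≥ 2`
  have hn : 1 ≤ n := by
    rcases Nat.eq_zero_or_pos n with rfl | h
    · obtain ⟨z, hz⟩ := hsol
      exact absurd (eq_zero_of_solvable_of_isEmpty (hz i₀)) hi₀
    · exact h
  have hw : 1 ≤ w := by
    by_contra hw0
    exact hi₀ (eq_zero_of_weight_eq_zero (by have := hwt i₀; omega))
  have hd2 : 2 ≤ d := by omega
  -- degenerate case: `x ≤ 1` (`π(x) = 0`)
  by_cases hx2 : x < 2
  · have hπ : Nat.primeCounting x = 0 := Nat.primeCounting_eq_zero_iff.2 (by omega)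
    rw [hπ, Nat.cast_zero, zero_div]
    linarith
  push Not at hx2
  -- the main case: `x ≥ 2`
  have hx1 : (1 : ℝ) ≤ x := by exact_mod_cast (show 1 ≤ x by omega)
  have hxpos : (0 : ℝ) < x := by linarith
  have hwpos : (0 : ℝ) < w := by exact_mod_cast hw
  have hsx1 : 1 ≤ Real.sqrt (x : ℝ) := by
    rw [← Real.sqrt_one]; exact Real.sqrt_le_sqrt hx1
  have hlog2 : (1 : ℝ) / 2 ≤ Real.log 2 := by
    have := Real.log_two_gt_d9; linarith
  have hlogw0 : 0 ≤ Real.log w := Real.log_nonneg (by exact_mod_cast hw)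
  have hlogx0 : 0 ≤ Real.log x := Real.log_nonneg hx1
  have hLsplit : Real.log ((w : ℝ) * x) = Real.log w + Real.log x :=
    Real.log_mul hwpos.ne' hxpos.ne'
  have hlogwL : Real.log w ≤ Real.log ((w : ℝ) * x) := by linarith
  have hlogxL : Real.log x ≤ Real.log ((w : ℝ) * x) := by linarith
  have hL2 : 1 / 2 ≤ Real.log ((w : ℝ) * x) := by
    have : Real.log 2 ≤ Real.log x := Real.log_le_log two_pos (by exact_mod_cast hx2)
    linarith
  -- Theorem 4.5: the algebraic solution
  obtain ⟨lam, v, g, y, hlam, hirr, hprim, hdg, hgy, hsolv, hdegg, -, hloglam, hlogwg, -⟩ :=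
    h45 n s d w S hnd hdeg hwt hsol
  -- `D = d^{an} ≥ 2a`, `A = a D`
  obtain ⟨D, hD⟩ : ∃ D : ℝ, D = (d : ℝ) ^ (a * n) := ⟨_, rfl⟩
  have ha1' : (1 : ℝ) ≤ a := by exact_mod_cast ha1
  have hD2a : 2 * (a : ℝ) ≤ D := by
    have h1 : (2 : ℝ) ^ a ≤ (d : ℝ) ^ a :=
      pow_le_pow_left₀ (by norm_num) (by exact_mod_cast hd2) a
    have h2 : (d : ℝ) ^ a ≤ D := by
      rw [hD]; exact pow_le_pow_right₀ (by exact_mod_cast hd1) (Nat.le_mul_of_pos_right a hn)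
    have h3 : ((2 * a : ℕ) : ℝ) ≤ ((2 ^ a : ℕ) : ℝ) := by exact_mod_cast two_mul_le_two_pow ha1
    push_cast at h3
    linarith
  have hA1 : (1 : ℝ) ≤ a * D := by nlinarith
  have hA0 : (0 : ℝ) ≤ a * D := by linarith
  have hup : (a₀ : ℝ) * (d : ℝ) ^ (a₀ * n) ≤ a * D := by
    rw [hD]
    exact mul_le_mul (by exact_mod_cast ha0) (pow_le_pow_right₀ (by exact_mod_cast hd1)
      (Nat.mul_le_mul_right n ha0)) (by positivity) (by positivity)
  have hdgA : (g.natDegree : ℝ) ≤ a * D := hdegg.trans hup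
  have hloglamA : Real.log lam ≤ a * D * Real.log ((w : ℝ) * x) :=
    hloglam.trans (mul_le_mul hup hlogwL hlogw0 hA0)
  have hlogwgA : Real.log (polyWeight g) ≤ a * D * Real.log ((w : ℝ) * x) :=
    hlogwg.trans (mul_le_mul hup hlogwL hlogw0 hA0)
  have hdg1 : (1 : ℝ) ≤ g.natDegree := by exact_mod_cast hdg
  have hdgpos : (0 : ℝ) < g.natDegree := by linarith
  have hwg1 : (1 : ℝ) ≤ (polyWeight g : ℕ) := by exact_mod_cast one_le_polyWeight hirr.ne_zero
  have hwgpos : (0 : ℝ) < (polyWeight g : ℕ) := by linarith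
  have hlogdg0 : 0 ≤ Real.log g.natDegree := Real.log_nonneg hdg1
  have hlogdgA : Real.log g.natDegree ≤ a * D := by
    have := Real.log_le_sub_one_of_pos hdgpos
    linarith
  have hlogwg0 : 0 ≤ Real.log (polyWeight g : ℕ) := Real.log_nonneg hwg1
  -- Corollary 4.8 for `g` (weight bound `wt(g)` itself)
  have h48g := h48 g (polyWeight g) hirr hdg le_rfl x
  rw [Real.log_mul (by positivity) hxpos.ne', Real.log_mul hdgpos.ne' hwgpos.ne'] at h48g
  -- Remark 4.6: `π_g ≤ π_S + ω(λ)`, and `ω(λ) log 2 ≤ log λ`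
  have hcount : (rootModPrimeCount g x : ℝ) ≤
      solvableModPrimeCount S x + lam.primeFactors.card := by
    exact_mod_cast rootModPrimeCount_le S hlam v hirr hprim hgy hsolv x
  have hω : (lam.primeFactors.card : ℝ) * (1 / 2) ≤ Real.log lam :=
    le_trans (mul_le_mul_of_nonneg_left hlog2 (Nat.cast_nonneg _))
      (card_primeFactors_mul_log_two_le hlam)
  -- the junk terms
  have hJ := thm41_junk (ω := (lam.primeFactors.card : ℝ)) hK0 hA1 hL2 hsx1 hdgA hlogdg0
    hlogdgA hlogwg0 hlogwgA hlogxL hloglamA hω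
  -- the main term: `π(x)/deg g ≥ π(x)/A`
  have hmain : (Nat.primeCounting x : ℝ) / (a * D) ≤ (Nat.primeCounting x : ℝ) / g.natDegree :=
    div_le_div_of_nonneg_left hπ0 hdgpos hdgA
  have hπS : (Nat.primeCounting x : ℝ) / (a * D) -
      (K * (Real.sqrt x * (Real.log g.natDegree + Real.log (polyWeight g : ℕ) + Real.log x) +
        g.natDegree * (Real.log g.natDegree + Real.log (polyWeight g : ℕ))) +
        lam.primeFactors.card) ≤ solvableModPrimeCount S x := by
    linarith
  -- absorb
  rw [show 4 * a * n = a * n * 4 by ring, pow_mul, ← hD]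
  exact thm41_absorb hπ0 ha1' hD2a (by positivity) hsx0 hL0 hπS0 hJ hπS

end Combination

end Literature.Computability.AlgebraicComplexity
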